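import Summits.CriticalPhenomena.SAWScalingLimit.Theorems.SAWLeftRightFKGFKGToTraversalBoundBBFourPointFacts
import Summits.CriticalPhenomena.SAWScalingLimit.Theorems.SAWLeftRightFKGFKGToTraversalBoundBBFourPointConnectors
import Summits.CriticalPhenomena.SAWScalingLimit.Theorems.SAWLeftRightFKGFKGToTraversalBoundBBRefineTour
import Summits.CriticalPhenomena.SAWScalingLimit.Theorems.SAWLeftRightFKGFKGToTraversalBoundBBRefineConn
import Summits.CriticalPhenomena.SAWScalingLimit.Theorems.SAWLeftRightFKGFKGToTraversalBoundOutlineAbab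
import HarnessLib

/-!
# Boundary budget (U6), unit BB5, part 3a: the planar heart — no two disjoint exterior connectors

Crux `SAWLeftRightFKG.FKGToTraversalBound` (stmt-CriticalPhenomena-1878), line `slit-necklace`, lead
prover-line-stmt-CriticalPhenomena-1878-c5-0; wave 6 (the BOUNDARY BUDGET), unit BB5 (the four-point lemma
`bb_four_point`), part 3a, on top of `…BBFourPointFacts` (`bbp_refineFacts`: the fine body set `A`),
`…BBFourPointConnectors` (`bbp_connectors`: lattice connectors along a path avoiding the coarse body), the siblings
`…BBRefineTour` (`bb_refine_tour`: the fine tour simulates the coarse tour) and `…BBRefineConn`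
(`bb_refine_connected`), and `…OutlineAbab` (`btour_abab`: no `X, Y, X, Y` reading of contacts along a tour period).

* `bbp_core` (registered helper) — let `B` be a discretised `4`-connected piece of a Dobrushin domain `D` at mesh
  `δ`, `e` a boundary edge with injective tour period `N`, `P 0 < P 1 < P 2 < P 3 < P 0 + N` four tour positions
  with pairwise distinct FEET `F i` (first frontier points on the segments outline site → contact site).  Then there
  are NO two disjoint paths `πX : F 0 ⟶ F 2`, `πY : F 1 ⟶ F 3` running outside `closure D` except at their ends.
  Proof: choose `M` so large that `η = δ / M` is below every `dist (F i, x i)` and `4 η` is below the distances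
  between `[x 0, F 0] ∪ [x 2, F 2] ∪ πX` and `πY` and between `[x 1, F 1] ∪ [x 3, F 3]` and `πX`
  (`exists_pos_forall_le_dist`); no point of `πX`, `πY` has all its sup-norm-close coarse sites in `B`, so
  `bbp_connectors` yields `4`-connected fine sets `X ∋` the fine contacts of positions `P 0, P 2` and `Y ∋` those of
  `P 1, P 3` inside `Aᶜ`, disjoint by the choice of `M` (and because spoke sites of distinct boundary edges are
  distinct); along the simulated fine tour (`bb_refine_tour`) the contacts then read `X, Y, X, Y`, contradicting
  `btour_abab`.
* riders: `bbp_spoke_disjoint`, `bbp_spoke_mem_segment`, `bbp_not_kbr_of_foot`, `bbp_dist_of_close`,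
  `bbp_rebase`, `bbp_ne_of_seg`.

All statements folklore (plane topology bookkeeping); no literature fact is introduced; nothing restates the crux.
-/

noncomputable section

open Filter Topology Set Metric
open Literature.Probability.LatticeModels
open Literature.Probability.RandomPlanarGeometry
open Literature.Topology.PlaneTopology

namespace Summit.CriticalPhenomena.SAWScalingLimit.Theorems.FKGToTraversalBound.SlitNecklace

/-! ### Small geometric bookkeeping -/

/-- The unit vectors of distinct directions are distinct. [folklore] -/
private theorem bbp_vec_injective {d d' : ODir} (h : d.vec = d'.vec) : d = d' := by
  have h0 := congrFun h 0
  have h1 := congrFun h 1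
  fin_cases d <;> fin_cases d' <;> first | rfl | (exfalso; revert h0 h1; simp [ODir.vec])

/-- A closed segment of the plane is compact. [folklore] -/
private theorem bbp_isCompact_segment (a b : ℂ) : IsCompact (segment ℝ a b) := by
  rw [segment_eq_image']
  exact isCompact_Icc.image (by fun_prop)

/-- Two points each within sup-distance `η` of the mesh point of one fine site are within distance `4 η`.
[folklore] -/
private theorem bbp_dist_of_close {η : ℝ} {s : Site 2} {p q : ℂ} (hp0 : |η * s 0 - p.re| ≤ η)
    (hp1 : |η * s 1 - p.im| ≤ η) (hq0 : |η * s 0 - q.re| ≤ η) (hq1 : |η * s 1 - q.im| ≤ η) :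
    dist p q ≤ 4 * η := by
  rw [Complex.dist_eq]
  calc ‖p - q‖ ≤ |(p - q).re| + |(p - q).im| := Complex.norm_le_abs_re_add_abs_im _
    _ = |p.re - q.re| + |p.im - q.im| := by simp
    _ ≤ (|p.re - η * s 0| + |η * s 0 - q.re|) + (|p.im - η * s 1| + |η * s 1 - q.im|) :=
        add_le_add (abs_sub_le _ _ _) (abs_sub_le _ _ _)
    _ ≤ (η + η) + (η + η) := by rw [abs_sub_comm] at hp0 hp1; gcongr
    _ = 4 * η := by ring

/-- A point of the coarse boundary segment `[x, x + d]` other than the mesh point of `x` has the coarse site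
`x + d ∉ B` sup-norm-close: it fails the box property. [folklore] -/
private theorem bbp_not_kbr_of_foot {B : Finset (Site 2)} {δ : ℝ} (hδ : 0 < δ) {x : Site 2} {d : ODir}
    (hc : x + d.vec ∉ B) {F : ℂ} (hF : F ∈ segment ℝ (meshPoint δ x) (meshPoint δ (x + d.vec)))
    (hFx : F ≠ meshPoint δ x) :
    ¬ ∀ z : Site 2, |F.re - δ * z 0| < δ → |F.im - δ * z 1| < δ → z ∈ B := by
  intro h
  rw [segment_eq_image'] at hF
  obtain ⟨σ, ⟨h0, h1⟩, rfl⟩ := hF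
  have hσ : 0 < σ := by
    rcases h0.eq_or_lt with rfl | h'
    · simp at hFx
    · exact h'
  refine hc (h (x + d.vec) ?_ ?_)
  · have : (meshPoint δ x + σ • (meshPoint δ (x + d.vec) - meshPoint δ x)).re - δ * ((x + d.vec) 0 : ℤ) =
        (σ - 1) * δ * d.vec 0 := by
      simp
      ring
    rw [this, abs_mul, abs_mul, abs_of_pos hδ, abs_of_nonpos (by linarith)]
    calc -(σ - 1) * δ * |(d.vec 0 : ℝ)| ≤ -(σ - 1) * δ * 1 := by
          gcongr
          · nlinarith
          · exact_mod_cast ODir.abs_vec_apply_le d 0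
      _ < δ := by nlinarith
  · have : (meshPoint δ x + σ • (meshPoint δ (x + d.vec) - meshPoint δ x)).im - δ * ((x + d.vec) 1 : ℤ) =
        (σ - 1) * δ * d.vec 1 := by
      simp
      ring
    rw [this, abs_mul, abs_mul, abs_of_pos hδ, abs_of_nonpos (by linarith)]
    calc -(σ - 1) * δ * |(d.vec 1 : ℝ)| ≤ -(σ - 1) * δ * 1 := by
          gcongr
          · nlinarith
          · exact_mod_cast ODir.abs_vec_apply_le d 1
      _ < δ := by nlinarith

/-- The mesh point of a spoke site `M • x + t • d` below a point `u` of the coarse segment `[x, x + d]`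
(`0 ≤ t`, `t η ≤ dist u x`) lies on the segment from the mesh point of `x` to `u`. [folklore] -/
private theorem bbp_spoke_mem_segment {δ : ℝ} {M : ℕ} (hδ : 0 < δ) (hM : 0 < M) {x : Site 2} {d : ODir} {u : ℂ}
    (hu : u ∈ segment ℝ (meshPoint δ x) (meshPoint δ (x + d.vec))) {t : ℤ} (ht0 : 0 ≤ t)
    (ht : (t : ℝ) * (δ / M) ≤ dist u (meshPoint δ x)) :
    meshPoint (δ / M) ((M : ℤ) • x + t • d.vec) ∈ segment ℝ (meshPoint δ x) u := by
  have hM0 : (0 : ℝ) < M := by exact_mod_cast hM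
  rw [segment_eq_image'] at hu
  obtain ⟨σ, ⟨h0, h1⟩, rfl⟩ := hu
  have hdiff : meshPoint δ (x + d.vec) - meshPoint δ x = (δ : ℂ) * Site.toComplex d.vec := by
    apply Complex.ext <;> simp [meshPoint] <;> ring
  have hnorm : ‖Site.toComplex d.vec‖ = 1 := by
    fin_cases d <;> simp [Site.toComplex, ODir.vec, Complex.norm_eq_sqrt_sq_add_sq]
  have hdist : dist (meshPoint δ x + σ • (meshPoint δ (x + d.vec) - meshPoint δ x)) (meshPoint δ x) = σ * δ := by
    rw [Complex.dist_eq, add_sub_cancel_left, hdiff, norm_smul, norm_mul, hnorm, Complex.norm_real,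
      Real.norm_of_nonneg h0, Real.norm_of_nonneg hδ.le, mul_one]
  rw [hdist] at ht
  dsimp only at ht ⊢
  rcases h0.eq_or_lt with rfl | hσ
  · have ht' : (t : ℝ) * (δ / M) = 0 := le_antisymm (by simpa using ht) (by positivity)
    have : (t : ℝ) = 0 := (mul_eq_zero.1 ht').resolve_right (div_pos hδ hM0).ne'
    have ht0 : t = 0 := by exact_mod_cast this
    subst ht0
    rw [zero_smul, add_zero, zero_smul, add_zero]
    convert left_mem_segment ℝ (meshPoint δ x) (meshPoint δ x) using 1
    apply Complex.ext <;> simp [meshPoint] <;> field_simp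
  · rw [segment_eq_image']
    set lam : ℝ := t * (δ / M) / (σ * δ) with hlam
    have hlam' : lam * (σ * δ) = t * (δ / M) := by rw [hlam]; field_simp
    refine ⟨lam, ⟨by positivity, div_le_one_of_le₀ ht (by positivity)⟩, ?_⟩
    have hsplit : ∀ a b : ℝ, δ / M * (M * a + t * b) = δ * a + t * (δ / M) * b := fun a b => by
      field_simp
    apply Complex.ext
    · simp [meshPoint]
      rw [hsplit]
      linear_combination (d.vec 0 : ℝ) * hlam'
    · simp [meshPoint]
      rw [hsplit]
      linear_combination (d.vec 1 : ℝ) * hlam'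

/-- **Spoke sites of distinct boundary edges are distinct.**  If `M • x + t • d = M • x' + t' • d'` with
`0 < t, t' < M` for boundary edges `(x, d)`, `(x', d')` of `B`, then the edges coincide (the coarse sites whose
open `M`-box contains the common fine site are exactly `x, x + d`, and also `x', x' + d'`). [folklore] -/
private theorem bbp_spoke_disjoint {B : Finset (Site 2)} {M : ℕ} (hM : 2 ≤ M) {x x' : Site 2} {d d' : ODir}
    (hx : x ∈ B) (hc : x + d.vec ∉ B) (hx' : x' ∈ B) (hc' : x' + d'.vec ∉ B) {t t' : ℤ} (ht0 : 0 < t)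
    (htM : t < M) (ht0' : 0 < t') (htM' : t' < M) (h : (M : ℤ) • x + t • d.vec = (M : ℤ) • x' + t' • d'.vec) :
    (x, d) = (x', d') := by
  classical
  obtain ⟨A₂, hA₂, hbox₂, -⟩ := bbp_bodySet ({x, x + d.vec} : Finset (Site 2)) M hM
  have hf : (M : ℤ) • x + t • d.vec ∈ A₂ :=
    (hA₂ _).2 (Or.inr (Or.inl ⟨x, by simp, d, by simp, t, ht0, htM, rfl⟩))
  have near : ∀ z : Site 2, (∀ i, |(M : ℤ) * z i - ((M : ℤ) • x' + t' • d'.vec) i| < M) →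
      z = x ∨ z = x + d.vec := by
    intro z hz
    have := (hbox₂ _).1 hf z (by rwa [h])
    simpa using this
  have hx'near : x' = x ∨ x' = x + d.vec := near x' fun i => by
    simp only [Pi.add_apply, Pi.smul_apply, smul_eq_mul]
    rw [show (M : ℤ) * x' i - (M * x' i + t' * d'.vec i) = -(t' * d'.vec i) by ring, abs_neg, abs_mul,
      abs_of_pos ht0']
    calc t' * |d'.vec i| ≤ t' * 1 := mul_le_mul_of_nonneg_left (ODir.abs_vec_apply_le d' i) ht0'.le
      _ < M := by omega
  have hc'near : x' + d'.vec = x ∨ x' + d'.vec = x + d.vec := near _ fun i => by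
    simp only [Pi.add_apply, Pi.smul_apply, smul_eq_mul]
    rw [show (M : ℤ) * (x' i + d'.vec i) - (M * x' i + t' * d'.vec i) = (M - t') * d'.vec i by ring, abs_mul,
      abs_of_nonneg (by omega : (0 : ℤ) ≤ M - t')]
    calc (M - t' : ℤ) * |d'.vec i| ≤ (M - t') * 1 :=
          mul_le_mul_of_nonneg_left (ODir.abs_vec_apply_le d' i) (by omega)
      _ < M := by omega
  obtain rfl : x' = x := by
    rcases hx'near with h' | h'
    · exact h'
    · exact absurd hx' (h' ▸ hc)
  rcases hc'near with h' | h'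
  · rw [h'] at hc'
    exact absurd hx' hc'
  · rw [bbp_vec_injective (add_left_cancel h').symm]

/-- Re-basing an injective period of the wall-follower tour at a later tour edge. [folklore] -/
private theorem bbp_rebase (A : Set (Site 2)) {e₀ : Site 2 × ODir} {N : ℕ} (hN : 0 < N)
    (hper : btour A e₀ N = e₀)
    (hinj : ∀ j j', j < N → j' < N → btour A e₀ j = btour A e₀ j' → j = j') (n₀ : ℕ) :
    btour A (btour A e₀ n₀) N = btour A e₀ n₀ ∧
      ∀ j j', j < N → j' < N → btour A (btour A e₀ n₀) j = btour A (btour A e₀ n₀) j' → j = j' := by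
  -- adapted from the start of the proof of `btour_abab` (…OutlineAbab)
  have hshift : ∀ k, btour A (btour A e₀ n₀) k = btour A e₀ (n₀ + k) := fun k => (btour_add _ e₀ n₀ k).symm
  refine ⟨by rw [hshift, btour_add_of_eq _ hper], fun j j' hj hj' h => ?_⟩
  rw [hshift, hshift, ← btour_mod_of_eq _ hper (n₀ + j), ← btour_mod_of_eq _ hper (n₀ + j')] at h
  have hmod : j % N = j' % N :=
    Nat.ModEq.add_left_cancel' n₀ (hinj _ _ (Nat.mod_lt _ hN) (Nat.mod_lt _ hN) h)
  rwa [Nat.mod_eq_of_lt hj, Nat.mod_eq_of_lt hj'] at hmod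

/-- A point of the half-open segment `[a, F i)` inside the open domain, or the foot `F i` itself, differs from
every point that is outside the closed domain or equals another foot. [folklore] -/
private theorem bbp_ne_of_seg {Ω : Set ℂ} (hΩ : IsOpen Ω) {F : Fin 4 → ℂ} (hFinj : Function.Injective F)
    (hfr : ∀ i, F i ∈ frontier Ω) {a : ℂ} {i : Fin 4} (hseg : ∀ z ∈ segment ℝ a (F i), z ≠ F i → z ∈ Ω)
    {z w : ℂ} (hz : z ∈ segment ℝ a (F i)) {j k : Fin 4} (hj : j ≠ i) (hk : k ≠ i)
    (hw : w ∉ closure Ω ∨ w = F j ∨ w = F k) : z ≠ w := by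
  rintro rfl
  have hnot : ∀ l, F l ∉ Ω := fun l h => by
    have := hfr l
    rw [hΩ.frontier_eq] at this
    exact this.2 h
  by_cases hzF : z = F i
  · rcases hw with hw | hw | hw
    · exact hw (hzF ▸ frontier_subset_closure (hfr i))
    · exact hj (hFinj (hw ▸ hzF.symm)).symm
    · exact hk (hFinj (hw ▸ hzF.symm)).symm
  · have hzΩ := hseg z hz hzF
    rcases hw with hw | hw | hw
    · exact hw (subset_closure hzΩ)
    · exact hnot j (hw ▸ hzΩ)
    · exact hnot k (hw ▸ hzΩ)

/-! ### The registered helper -/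

/-- **U6 BB5, part 3a (registered helper): the planar heart of the four-point lemma.**  For a discretised
`4`-connected piece `B` of a Dobrushin domain `D` at mesh `δ`, a boundary edge `e` with injective tour period `N`,
tour positions `P 0 < P 1 < P 2 < P 3 < P 0 + N` and pairwise distinct feet `F i` of the four end segments, there are
no two disjoint paths `F 0 ⟶ F 2` and `F 1 ⟶ F 3` of the plane running outside `closure D` except at their endpoints.
[folklore] -/
theorem bbp_core : ∀ (D : DobrushinDomain) (δ : ℝ) (B : Finset (Site 2)) (e : Site 2 × ODir) (N : ℕ) (P : Fin 4 → ℕ) (F : Fin 4 → ℂ) (πX : Path (F 0) (F 2)) (πY : Path (F 1) (F 3)), 0 < δ → (∀ x ∈ B, meshPoint δ x ∈ D.carrier) → (∀ x ∈ B, ∀ x' ∈ B, (zdGraph 2).Adj x x' → (discreteDomainGraph D.carrier δ).Adj x x') → (∀ x ∈ B, ∀ x' ∈ B, ∃ w : (zdGraph 2).Walk x x', ∀ z ∈ w.support, z ∈ B) → IsBEdge (↑B : Set (Site 2)) e → 0 < N → btour (↑B : Set (Site 2)) e N = e → (∀ j j', j < N → j' < N → btour (↑B : Set (Site 2)) e j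 = btour (↑B : Set (Site 2)) e j' → j = j') → P 0 < P 1 → P 1 < P 2 → P 2 < P 3 → P 3 < P 0 + N → (∀ i, (F i ∈ frontier D.carrier ∧ F i ∈ segment ℝ (meshPoint δ (bsite (btour (↑B : Set (Site 2)) e (P i)))) (meshPoint δ (bcontact (btour (↑B : Set (Site 2)) e (P i)))) ∧ F i ≠ meshPoint δ (bsite (btour (↑B : Set (Site 2)) e (P i))) ∧ ∀ z ∈ segment ℝ (meshPoint δ (bsite (btour (↑B : Set (Site 2)) e (P i)))) (F i), z ≠ F i → z ∈ D.carrier)) → Function.Injective F → (∀ t, πX t ∉ closure D.carrier ∨ πX t = F 0 ∨ πX t = F 2) → (∀ t, πY t ∉ closure D.carrier ∨ πY t = F 1 ∨ πY t = F 3) → (∀ s t, πX s ≠ πY t) → False := by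
  intro D δ B e N P F πX πY hδ hBD hBadj hBconn he hN hper hinj h01 h12 h23 h3N hF hFinj hπX hπY hdisj
  -- the four end edges
  obtain ⟨E, hE⟩ : ∃ E : Fin 4 → Site 2 × ODir, ∀ i, btour (↑B : Set (Site 2)) e (P i) = E i :=
    ⟨_, fun i => rfl⟩
  simp only [hE, bsite, bcontact] at hF
  have hEB : ∀ i, IsBEdge (↑B : Set (Site 2)) (E i) := fun i => hE i ▸ btour_isBEdge _ he _
  have hx : ∀ i, (E i).1 ∈ B := fun i => (hEB i).1
  have hc : ∀ i, (E i).1 + (E i).2.vec ∉ B := fun i => (hEB i).2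
  have hfr : ∀ i, F i ∈ frontier D.carrier := fun i => (hF i).1
  have hr : ∀ i, 0 < dist (F i) (meshPoint δ (E i).1) := fun i => dist_pos.2 (hF i).2.2.1
  have hrδ : ∀ i, dist (F i) (meshPoint δ (E i).1) ≤ δ := fun i => by
    obtain ⟨σ, -, h1, -, -, hd⟩ := bbp_seg_coords hδ (hF i).2.1
    rw [hd]
    nlinarith
  -- positive distances between the compact pieces
  set SX : Set ℂ := (segment ℝ (meshPoint δ (E 0).1) (F 0) ∪ segment ℝ (meshPoint δ (E 2).1) (F 2)) ∪ range πX
    with hSX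
  set SY : Set ℂ := segment ℝ (meshPoint δ (E 1).1) (F 1) ∪ segment ℝ (meshPoint δ (E 3).1) (F 3) with hSY
  have hSXc : IsCompact SX :=
    ((bbp_isCompact_segment _ _).union (bbp_isCompact_segment _ _)).union (isCompact_range πX.continuous)
  have hSYc : IsCompact SY := (bbp_isCompact_segment _ _).union (bbp_isCompact_segment _ _)
  have hXdisj : Disjoint SX (range πY) := by
    rw [Set.disjoint_left]
    rintro z hz ⟨t, rfl⟩
    rcases hz with (hz | hz) | ⟨s, hs⟩
    · exact bbp_ne_of_seg D.isOpen hFinj hfr (hF 0).2.2.2 hz (j := 1) (k := 3) (by decide) (by decide) (hπY t) rfl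
    · exact bbp_ne_of_seg D.isOpen hFinj hfr (hF 2).2.2.2 hz (j := 1) (k := 3) (by decide) (by decide) (hπY t) rfl
    · exact hdisj s t hs
  have hYdisj : Disjoint SY (range πX) := by
    rw [Set.disjoint_left]
    rintro z hz ⟨t, rfl⟩
    rcases hz with hz | hz
    · exact bbp_ne_of_seg D.isOpen hFinj hfr (hF 1).2.2.2 hz (j := 0) (k := 2) (by decide) (by decide) (hπX t) rfl
    · exact bbp_ne_of_seg D.isOpen hFinj hfr (hF 3).2.2.2 hz (j := 0) (k := 2) (by decide) (by decide) (hπX t) rfl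
  obtain ⟨ε₁, hε₁, hε₁d⟩ := exists_pos_forall_le_dist hSXc (isCompact_range πY.continuous).isClosed hXdisj
  obtain ⟨ε₂, hε₂, hε₂d⟩ := exists_pos_forall_le_dist hSYc (isCompact_range πX.continuous).isClosed hYdisj
  -- the refinement factor
  set ρ : ℝ := min (min ε₁ ε₂) (min (min (dist (F 0) (meshPoint δ (E 0).1)) (dist (F 1) (meshPoint δ (E 1).1)))
    (min (dist (F 2) (meshPoint δ (E 2).1)) (dist (F 3) (meshPoint δ (E 3).1)))) with hρ
  have hρpos : 0 < ρ := lt_min (lt_min hε₁ hε₂) (lt_min (lt_min (hr 0) (hr 1)) (lt_min (hr 2) (hr 3)))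
  obtain ⟨M, hMgt⟩ := exists_nat_gt (max 2 (4 * δ / ρ))
  have hM2 : 2 ≤ M := by
    have : (2 : ℝ) < M := lt_of_le_of_lt (le_max_left _ _) hMgt
    exact_mod_cast this.le
  have hM0 : (0 : ℝ) < M := by exact_mod_cast (show 0 < M by omega)
  have hη : 0 < δ / M := div_pos hδ hM0
  have hη4 : 4 * (δ / M) < ρ := by
    have h1 : 4 * δ / ρ < M := lt_of_le_of_lt (le_max_right _ _) hMgt
    rw [div_lt_iff₀ hρpos] at h1
    rw [mul_div_assoc', div_lt_iff₀ hM0]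
    linarith
  have hρ1 : ρ ≤ ε₁ := le_trans (min_le_left _ _) (min_le_left _ _)
  have hρ2 : ρ ≤ ε₂ := le_trans (min_le_left _ _) (min_le_right _ _)
  have hηr : ∀ i, δ / M < dist (F i) (meshPoint δ (E i).1) := by
    have h' : δ / M < ρ := by linarith
    intro i
    fin_cases i <;> refine lt_of_lt_of_le h' (le_trans (min_le_right _ _) ?_)
    exacts [le_trans (min_le_left _ _) (min_le_left _ _), le_trans (min_le_left _ _) (min_le_right _ _),
      le_trans (min_le_right _ _) (min_le_left _ _), le_trans (min_le_right _ _) (min_le_right _ _)]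
  have htM : ∀ (i : Fin 4) (t : ℤ), (t : ℝ) * (δ / M) < dist (F i) (meshPoint δ (E i).1) → t < M := by
    intro i t ht
    have h1 : (t : ℝ) * (δ / M) < (M : ℝ) * (δ / M) := by
      calc (t : ℝ) * (δ / M) < dist (F i) (meshPoint δ (E i).1) := ht
        _ ≤ δ := hrδ i
        _ = (M : ℝ) * (δ / M) := by field_simp
    have h2 : (t : ℝ) < M := lt_of_mul_lt_mul_right h1 hη.le
    exact_mod_cast h2
  -- the fine body set, the re-based coarse tour and the simulating fine tour
  obtain ⟨A, hA3, hAbox, hnp, hkbr, havoid⟩ := bbp_refineFacts D δ B M hδ hM2 hBD hBadj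
  have hAconn := bb_refine_connected B A M hM2 hA3 hBconn
  have hP0 : ∀ i, P 0 ≤ P i := fun i => by fin_cases i <;> simp <;> omega
  have hPN : ∀ i, P i < P 0 + N := fun i => by fin_cases i <;> simp <;> omega
  obtain ⟨hper', hinj'⟩ := bbp_rebase (↑B : Set (Site 2)) hN hper hinj (P 0)
  rw [hE 0] at hper' hinj'
  have hEQ : ∀ i, btour (↑B : Set (Site 2)) (E 0) (P i - P 0) = E i := fun i => by
    rw [← hE 0, ← btour_add, Nat.add_sub_cancel' (hP0 i), hE i]
  obtain ⟨Φ, hΦ0, hΦmono, hιe, hsim, hret, hinjA⟩ :=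
    bb_refine_tour B A M (E 0) N hM2 hA3 (hEB 0) hN hper' hinj'
  have hEne : ∀ i j, P i < P j → E i ≠ E j := by
    intro i j hij hEij
    have h1 : P i - P 0 < N := by have := hP0 i; have := hPN i; omega
    have h2 : P j - P 0 < N := by have := hP0 j; have := hPN j; omega
    have := hinj' _ _ h1 h2 (by rw [hEQ, hEQ, hEij])
    have := hP0 i
    omega
  -- the lattice connectors
  have hnk : ∀ i, ¬ ∀ z : Site 2, |(F i).re - δ * z 0| < δ → |(F i).im - δ * z 1| < δ → z ∈ B :=
    fun i => bbp_not_kbr_of_foot hδ (hc i) (hF i).2.1 (hF i).2.2.1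
  have hπX' : ∀ t, ¬ ∀ z : Site 2, |(πX t).re - δ * z 0| < δ → |(πX t).im - δ * z 1| < δ → z ∈ B := by
    intro t h
    rcases hπX t with h' | h' | h'
    · exact h' (hkbr _ h)
    · exact hnk 0 (by rw [← h']; exact h)
    · exact hnk 2 (by rw [← h']; exact h)
  have hπY' : ∀ t, ¬ ∀ z : Site 2, |(πY t).re - δ * z 0| < δ → |(πY t).im - δ * z 1| < δ → z ∈ B := by
    intro t h
    rcases hπY t with h' | h' | h'
    · exact h' (hkbr _ h)
    · exact hnk 1 (by rw [← h']; exact h)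
    · exact hnk 3 (by rw [← h']; exact h)
  obtain ⟨X, hXA, hXc, hX0, hX2, hXcases⟩ := bbp_connectors B A δ M (E 0).1 (E 2).1 (E 0).2 (E 2).2 (F 0) (F 2)
    πX hδ hM2 hAbox hnp havoid (hc 0) (hc 2) (hF 0).2.1 (hηr 0) (hF 2).2.1 (hηr 2) hπX'
  obtain ⟨Y, hYA, hYc, hY1, hY3, hYcases⟩ := bbp_connectors B A δ M (E 1).1 (E 3).1 (E 1).2 (E 3).2 (F 1) (F 3)
    πY hδ hM2 hAbox hnp havoid (hc 1) (hc 3) (hF 1).2.1 (hηr 1) (hF 3).2.1 (hηr 3) hπY'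
  -- a spoke site: its mesh point lies on the end segment and is sup-norm close to the site
  have hspoke : ∀ (i : Fin 4) (t : ℤ), 0 < t → (t : ℝ) * (δ / M) < dist (F i) (meshPoint δ (E i).1) →
      meshPoint (δ / M) ((M : ℤ) • (E i).1 + t • (E i).2.vec) ∈ segment ℝ (meshPoint δ (E i).1) (F i) ∧
      |δ / M * (((M : ℤ) • (E i).1 + t • (E i).2.vec) 0 : ℤ) -
          (meshPoint (δ / M) ((M : ℤ) • (E i).1 + t • (E i).2.vec)).re| ≤ δ / M ∧
      |δ / M * (((M : ℤ) • (E i).1 + t • (E i).2.vec) 1 : ℤ) -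
          (meshPoint (δ / M) ((M : ℤ) • (E i).1 + t • (E i).2.vec)).im| ≤ δ / M := by
    intro i t ht0 ht
    refine ⟨bbp_spoke_mem_segment hδ (by omega) (hF i).2.1 ht0.le ht.le, ?_, ?_⟩
    · rw [meshPoint_re, sub_self, abs_zero]
      exact hη.le
    · rw [meshPoint_im, sub_self, abs_zero]
      exact hη.le
  -- the two connectors are disjoint
  have hXY : Disjoint (↑X : Set (Site 2)) (↑Y : Set (Site 2)) := by
    rw [Finset.disjoint_coe, Finset.disjoint_left]
    intro s hsX hsY
    rcases hXcases s hsX with ⟨t, ht0, ht, rfl⟩ | ⟨t, ht0, ht, rfl⟩ | ⟨tX, hcX0, hcX1⟩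
    · rcases hYcases _ hsY with ⟨t', ht0', ht', heq⟩ | ⟨t', ht0', ht', heq⟩ | ⟨tY, hcY0, hcY1⟩
      · exact hEne 0 1 h01 (bbp_spoke_disjoint hM2 (hx 0) (hc 0) (hx 1) (hc 1) ht0 (htM 0 t ht) ht0'
          (htM 1 t' ht') heq)
      · exact hEne 0 3 (by omega) (bbp_spoke_disjoint hM2 (hx 0) (hc 0) (hx 3) (hc 3) ht0 (htM 0 t ht) ht0'
          (htM 3 t' ht') heq)
      · obtain ⟨hseg, h0, h1⟩ := hspoke 0 t ht0 ht
        have hd := bbp_dist_of_close h0 h1 hcY0 hcY1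
        have := hε₁d _ (Or.inl (Or.inl hseg)) (πY tY) ⟨tY, rfl⟩
        linarith
    · rcases hYcases _ hsY with ⟨t', ht0', ht', heq⟩ | ⟨t', ht0', ht', heq⟩ | ⟨tY, hcY0, hcY1⟩
      · exact hEne 1 2 h12 (bbp_spoke_disjoint hM2 (hx 2) (hc 2) (hx 1) (hc 1) ht0 (htM 2 t ht) ht0'
          (htM 1 t' ht') heq).symm
      · exact hEne 2 3 h23 (bbp_spoke_disjoint hM2 (hx 2) (hc 2) (hx 3) (hc 3) ht0 (htM 2 t ht) ht0'
          (htM 3 t' ht') heq)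
      · obtain ⟨hseg, h0, h1⟩ := hspoke 2 t ht0 ht
        have hd := bbp_dist_of_close h0 h1 hcY0 hcY1
        have := hε₁d _ (Or.inl (Or.inr hseg)) (πY tY) ⟨tY, rfl⟩
        linarith
    · rcases hYcases _ hsY with ⟨t', ht0', ht', heq⟩ | ⟨t', ht0', ht', heq⟩ | ⟨tY, hcY0, hcY1⟩
      · subst heq
        obtain ⟨hseg, h0, h1⟩ := hspoke 1 t' ht0' ht'
        have hd := bbp_dist_of_close h0 h1 hcX0 hcX1
        have := hε₂d _ (Or.inl hseg) (πX tX) ⟨tX, rfl⟩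
        linarith
      · subst heq
        obtain ⟨hseg, h0, h1⟩ := hspoke 3 t' ht0' ht'
        have hd := bbp_dist_of_close h0 h1 hcX0 hcX1
        have := hε₂d _ (Or.inr hseg) (πX tX) ⟨tX, rfl⟩
        linarith
      · have hd := bbp_dist_of_close hcX0 hcX1 hcY0 hcY1
        have := hε₁d _ (Or.inr ⟨tX, rfl⟩) (πY tY) ⟨tY, rfl⟩
        linarith
  -- the contacts along the fine tour read `X, Y, X, Y`
  refine btour_abab A (↑X) (↑Y) ((M : ℤ) • (E 0).1, (E 0).2) (Φ (P 0 - P 0)) (Φ (P 1 - P 0)) (Φ (P 2 - P 0))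
    (Φ (P 3 - P 0)) (Φ N) hιe hAconn (fun s hs => hXA s hs) (fun s hs => hYA s hs) hXY
    (fun s hs s' hs' => hXc s hs s' hs') (fun s hs s' hs' => hYc s hs s' hs') (hΦmono (by omega))
    (hΦmono (by omega)) (hΦmono (by omega)) ?_ hret hinjA ?_ ?_ ?_ ?_
  · rw [Nat.sub_self, hΦ0, zero_add]
    exact hΦmono (by omega)
  · rw [hsim, hEQ]
    exact hX0
  · rw [hsim, hEQ]
    exact hY1
  · rw [hsim, hEQ]
    exact hX2
  · rw [hsim, hEQ]
    exact hY3

end Summit.CriticalPhenomena.SAWScalingLimit.Theorems.FKGToTraversalBound.SlitNecklace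

end
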